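import Summits.HodgeConjecture.HodgeConjecture.Theorems.Ring2WeilCoverageCMFieldCarrierGalois
import Literature.NumberTheory.NumberFields.NonGaloisQuarticCMField
import HarnessLib

/-!
# Ring 2 — Weil-type family-coverage census, CM-field rows (X-L): the census carriers I — `ℚ(ζ₅)` and
# `ℚ(√-(2+√2))` CYCLIC, `ℚ(√-(3+√2))` NON-GALOIS in the kernel — and on EVERY row `W8.E.δ` of their tables a CM
# eightfold `B⁴` (`B` a simple CM surface) with HC in the kernel; the four biquadratic fields in part X-M

HONEST FRAMING: research route conditional on HC_CM; not a corollary; Q11.4-sentence-2 already refuted in dim ≥ 3.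

Cell `pub-hodge-ring2`, seat `ring2-b03` (gen 56), census `WEIL-FAMILY-COVERAGE.md` «## b03», open cell (xi′) of b03.20
CLOSED: the uniform member theorems of parts X-A … X-I are INSTANTIATED on each census table's own carrier
(`Ring2WeilCoverageCMFieldZeta5`, `…TablesA/B/C`, `…RowsA–E`, `…AllPrimes*`: `R = S² + pS + q` with
`(p, q) = (5,5), (6,1), (8,4), (9,9), (3,1), (4,2), (6,7)`), by the Galois criteria of part X-K fed with explicit
elements of `E = ℚ(η)`, `η⁴ + pη² + q = 0`, checked by `linear_combination`:

| field `E` | `(p,q)` | `η'` (`η'² = -η² - p`) | structure | extra element |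
|---|---|---|---|---|
| `ℚ(ζ₅)` | `(5,5)` | `-η³ - 3η` | cyclic: `u = -T³ - 3T`, `u(η') = -η` | — |
| `ℚ(√-(2+√2))` | `(4,2)` | `-η³ - 3η` | cyclic: same `u` | — |
| `ℚ(ζ₈) = ℚ(i,√2)` | `(6,1)` | `-η³ - 6η = 1/η` | `V₄` | `i = -(η³ + 5η)/2` |
| `ℚ(ζ₁₂) = ℚ(i,√3)` | `(8,4)` | `-(η³ + 8η)/2 = 2/η` | `V₄` | `i = -(η³ + 6η)/4` |
| `ℚ(√-3,√5)` | `(9,9)` | `-(η³ + 9η)/3 = 3/η` | `V₄` | `√-3 = -(η³ + 6η)/3` |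
| `ℚ(i,√5)` | `(3,1)` | `-η³ - 3η = 1/η` | `V₄` | `i = -η³ - 2η` |
| `ℚ(√-(3+√2))` | `(6,7)` | none in `E` (`ηη' = √7 ∉ E`) | non-Galois (`D₄` closure) | Literature `NonGaloisQuarticCM.KD` |

* §0 all `E`-ranks `2p` on the carrier (`carrier_exists_simplePower_hodgeConjectureFor_of_isCyclic`, X-C; `carrier_exists_cmMember_hodgeConjectureFor_of_not_isGalois`, X-G with Schappacher/Yanai): rows `W_{4p}.E.δ`, `g = 4p = 4, 8, 12, …` (the `g = 12` index rows of census b03.8).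
* §1 `isGalois_adjoinRoot_congr`, `sqrtNegThreePlusSqrtTwo_not_isGalois` — transport of the Literature theorem
  `NonGaloisQuarticCM.not_isGalois_KD` (`ℚ[X]/(X⁴ + 6X² + 7)` is not normal) to the census carrier.
* §2–§4 per field (this file: `ℚ(ζ₅)`, `ℚ(√-(2+√2))`, `ℚ(√-(3+√2))`; the biquadratic rows of the table above in the
  sequel X-M `Ring2WeilCoverageCMFieldCarrierInstancesBiquadratic`): `…_isGalois`, `…_isCyclic` (cyclic fields), and
`…_carrier_allRanks_hodgeConjectureFor` (every `p ≥ 1`), and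
  **`…_carrier_rows_hodgeConjectureFor`: for EVERY
  `δ ∈ cmNormResidueGroup R` — the index type of the kernel tables of parts I–W — a CM eightfold `A` (for the
  cyclic and the non-Galois field `A ≅ B⁴` with `B` a simple CM surface; for the biquadratic fields `B ~ C₁²` of
  induced type) with a Weil-type `(2,2;2,2)` datum relative to `E`, a Rosati-compatible polarization class of
  discriminant `δ`, `HodgeConjectureFor A.dim A.X` (kernel: Pohlmann / Hazama, unconditional) and
  `W_E(A) ⊗ ℂ ⊂ H⁴` algebraic.** With parts I–W (which DECIDE `[n] = [1]` / the row structure on the same type)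
  every census row `W8.E.δ` now carries, on ONE type, its decided class AND a CM member at which HC holds.

THEOREMS ONLY: no `def`, no named fact, no `sorry`; `HC_CM` does not occur. HONEST COLUMN: named CM members only;
nothing at the general member of any row (crux stmt-1076); the sign of `δ` is not recorded by `IsPolarizationClass`
(parts X-D – X-I: polarized members exist iff `δ ≫ 0`).

## References
* [Deligne1982HodgeCycles] P. Deligne (notes by J. S. Milne), LNM 900 (1982), §4 and §5 (c).
* [Shimura1998] G. Shimura, *Abelian Varieties with Complex Multiplication and Modular Functions* (1998), §8 Ex. 8.4 (2).
* [Streng2010] M. Streng, *Complex multiplication of abelian surfaces*, thesis Leiden 2010, Lemma I.3.4.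
* [Pohlmann1968] H. Pohlmann, Ann. of Math. 88 (1968), Thm. 1. [Gordon1999HodgeAVSurvey] B. Gordon (1999), Thm. 6.4.
-/

noncomputable section

set_option linter.dupNamespace false

namespace Summit.HodgeConjecture.HodgeConjecture.Ring2.WeilCoverageCM

open CategoryTheory CategoryTheory.Limits Polynomial NumberField
open Literature.AlgebraicGeometry Literature.AlgebraicGeometry.Motives Literature.AlgebraicGeometry.HodgeTheory
open Literature.AlgebraicGeometry.ComplexMultiplication Literature.AlgebraicGeometry.Deligne1982
open Literature.AlgebraicGeometry.Milne1999
open Summit.HodgeConjecture.HodgeConjecture.Ring2.Hypotheses (RosatiCompatible)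
open Literature.AlgebraicGeometry.Pohlmann1968 (IsNondegenerate isNondegenerate_of_isPrimitive_of_prime)
open Literature.NumberTheory.ComplexMultiplication (PrimitiveCMTypeNonGalois.exists_isPrimitive_of_not_isGalois)

/-! ## §0 All `E`-ranks `2p` on the carrier: cyclic and non-Galois quartic fields (rows `W_{4p}.E.δ`, `g = 4p = 4, 8, 12, …`) -/

section AllRanks

variable (R : Polynomial ℤ) [Fact (Irreducible (cmPolyQ R))] [Fact (Irreducible (realPolyQ R))]

/-- **X-C on the carrier, CYCLIC fields, EVERY `E`-rank `2p`:** for `R` monic of degree `e₀ ≥ 2` (presentation as in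
part X-J) with `E = cmField R` Galois CYCLIC over `ℚ`, every `p ≥ 1` and EVERY `δ ∈ cmNormResidueGroup R`: the power
`B^{2p}` of a SIMPLE CM abelian variety `B` of dimension `e₀` with a Weil-type datum of `E`-rank `2p`, a
Rosati-compatible polarization class of discriminant `δ`, the Hodge conjecture for `B^{2p}` (kernel: Pohlmann) and
`W_E(B^{2p}) ⊗ ℂ` algebraic — the rows `W_{2pe₀·2/2}.E.δ` of every rank (for `e₀ = 2`: `g = 4p = 4, 8, 12, …`, the
`g = 12` index rows of census b03.8 included). [cite: Pohlmann1968, Thm. 1] [cite: Deligne1982HodgeCycles, §5 (c) pp. 38–39] -/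
theorem carrier_exists_simplePower_hodgeConjectureFor_of_isCyclic (hRm : R.Monic) {e₀ : ℕ} (hRdeg : R.natDegree = e₀)
    (he₀ : 2 ≤ e₀) (hroots : ∀ s : ℂ, Polynomial.eval₂ (Int.castRingHom ℂ) s R = 0 → s.im = 0 ∧ s.re < 0)
    [IsCMField (cmField R)] [IsGalois ℚ (cmField R)] (hc : IsCyclic (cmField R ≃ₐ[ℚ] cmField R))
    {p : ℕ} (hp : 0 < p) (δ : cmNormResidueGroup R) :
    ∃ (B : AbelianVariety ℂ) (η : (⨁ fun _ : Fin (2 * p) => B) ⟶ ⨁ fun _ : Fin (2 * p) => B)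
      (h : complexBetti (⨁ fun _ : Fin (2 * p) => B).X 2),
      B.IsSimple ∧ B.dim = e₀ ∧ IsOfCMType B ∧
      IsOfCMType (⨁ fun _ : Fin (2 * p) => B) ∧ IsWeilTypeCM (⨁ fun _ : Fin (2 * p) => B) η R e₀ p ∧
      IsPolarizationClass (⨁ fun _ : Fin (2 * p) => B).dim (⨁ fun _ : Fin (2 * p) => B).X h ∧
      RosatiCompatible (⨁ fun _ : Fin (2 * p) => B) η h ∧
      HasWeilDiscriminantCM (⨁ fun _ : Fin (2 * p) => B) η R e₀ p h δ ∧
      HodgeConjectureFor (⨁ fun _ : Fin (2 * p) => B).dim (⨁ fun _ : Fin (2 * p) => B).X ∧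
      weilClassesField (⨁ fun _ : Fin (2 * p) => B) η (R.comp (X ^ 2)) (2 * p) ≤
        algebraicClasses (⨁ fun _ : Fin (2 * p) => B).X p := by
  obtain ⟨b₀, -, hb₀, hsep, he, hR, haev, hdegQ⟩ := carrier_presentation R hRm hRdeg hroots
  exact exists_simplePower_hodgeConjectureFor_of_isCyclic (cmField R) hc (by omega) hb₀ hsep he hRm hRdeg hR Fact.out
    hroots haev hdegQ hp δ

/-- **X-G on the carrier, NON-GALOIS QUARTIC fields, EVERY `E`-rank `2p`:** for `R` monic QUADRATIC (presentation as in
part X-J) with `E = cmField R` NOT Galois over `ℚ`, every `p ≥ 1` and EVERY `δ ∈ cmNormResidueGroup R`: a CM member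
(`B^{2p}`, `B` of a primitive — Schappacher — hence nondegenerate — Yanai — type) with a Weil-type datum of `E`-rank
`2p`, a Rosati-compatible polarization class of discriminant `δ`, the Hodge conjecture (kernel: Pohlmann) and
`W_E ⊗ ℂ` algebraic (`g = 4p`). [cite: Schmidt1984CMArithmetik, Kap. II Satz 1.6] [cite: Yanai1985, §4 Theorem]
[cite: Pohlmann1968, Thm. 1] -/
theorem carrier_exists_cmMember_hodgeConjectureFor_of_not_isGalois (hRm : R.Monic) (hRdeg : R.natDegree = 2)
    (hroots : ∀ s : ℂ, Polynomial.eval₂ (Int.castRingHom ℂ) s R = 0 → s.im = 0 ∧ s.re < 0)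
    [IsCMField (cmField R)] (hG : ¬ IsGalois ℚ (cmField R)) {p : ℕ} (hp : 0 < p) (δ : cmNormResidueGroup R) :
    ∃ (A : AbelianVariety ℂ) (η : A ⟶ A) (h : complexBetti A.X 2),
      IsOfCMType A ∧ IsWeilTypeCM A η R 2 p ∧ IsPolarizationClass A.dim A.X h ∧ RosatiCompatible A η h ∧
      HasWeilDiscriminantCM A η R 2 p h δ ∧ HodgeConjectureFor A.dim A.X ∧
      weilClassesField A η (R.comp (X ^ 2)) (2 * p) ≤ algebraicClasses A.X p := by
  obtain ⟨b₀, -, hb₀, hsep, he, hR, haev, hdegQ⟩ := carrier_presentation R hRm hRdeg hroots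
  obtain ⟨Θ, hΘ⟩ := PrimitiveCMTypeNonGalois.exists_isPrimitive_of_not_isGalois (K := cmField R) hG
  obtain ⟨φ₀⟩ : Nonempty (cmField R →+* ℂ) := inferInstance
  have h4 : Module.finrank ℚ (cmField R) = 2 * 2 := by rw [finrank_cmField, hRdeg]
  have hnd : IsNondegenerate Θ := isNondegenerate_of_isPrimitive_of_prime Nat.prime_two h4 φ₀ (hΘ φ₀)
  exact exists_cmMember_hodgeConjectureFor_of_exists_isNondegenerate (cmField R) (by omega) hb₀ hsep he hRm hRdeg hR
    Fact.out hroots haev hdegQ ⟨Θ, hnd⟩ hp δ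

end AllRanks

/-! ## §1 Transport of `IsGalois` along an equality of defining polynomials; the non-Galois carrier -/

/-- `IsGalois ℚ (ℚ[X]/(f))` only depends on `f`. [folklore] -/
theorem isGalois_adjoinRoot_congr {f g : Polynomial ℚ} (e : f = g) [Fact (Irreducible f)]
    [Fact (Irreducible g)] (h : IsGalois ℚ (AdjoinRoot f)) : IsGalois ℚ (AdjoinRoot g) := by
  subst e
  exact h

/-- `cmPolyQ (S² + 6S + 7) = X⁴ + 6X² + 7` is the quartic of `Literature.NonGaloisQuarticCMField`. [folklore] -/
theorem sqrtNegThreePlusSqrtTwo_cmPolyQ_eq_quartic {R : Polynomial ℤ} (hR : R = X ^ 2 + C 6 * X + C 7) :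
    cmPolyQ R = Literature.NumberTheory.NumberFields.NonGaloisQuarticCM.quartic := by
  rw [cmPolyQ_eq_of_quadratic hR, Literature.NumberTheory.NumberFields.NonGaloisQuarticCM.quartic]
  push_cast
  rw [map_ofNat, map_ofNat]

/-- **`ℚ(√-(3+√2)) = ℚ[T]/(T⁴ + 6T² + 7)` is NOT Galois over `ℚ`** (the `D₄` census field; Literature
`NonGaloisQuarticCM.not_isGalois_KD`: the conjugate root `i√(3-√2)` is not in `ℚ(i√(3+√2))` since `√7 ∉ ℚ(√2)`).
[cite: Shimura1998, §8 Ex. 8.4 (2)] [cite: Streng2010, Lemma I.3.4] -/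
theorem sqrtNegThreePlusSqrtTwo_not_isGalois {R : Polynomial ℤ} (hR : R = X ^ 2 + C 6 * X + C 7)
    [Fact (Irreducible (cmPolyQ R))] : ¬ IsGalois ℚ (cmField R) := by
  intro hG
  have e := sqrtNegThreePlusSqrtTwo_cmPolyQ_eq_quartic hR
  exact Literature.NumberTheory.NumberFields.NonGaloisQuarticCM.not_isGalois_KD (isGalois_adjoinRoot_congr e hG)

/-! ## §2 `ℚ(ζ₅)`: `R = S² + 5S + 5` (`η = ζ₅ - ζ₅⁻¹`), cyclic -/

section Zeta5

variable {R : Polynomial ℤ} (hR : R = X ^ 2 + C 5 * X + C 5)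
include hR

/-- The `Fact` for `E = ℚ(ζ₅) = ℚ[T]/(T⁴ + 5T² + 5)` (discriminant `5`). [folklore] -/
theorem zeta5_fact_cmPolyQ : Fact (Irreducible (cmPolyQ R)) :=
  fact_irreducible_cmPolyQ_of_pos hR (by norm_num) (by norm_num)
    (not_sq_of_eq_prime_mul_sq (ℓ := 5) Nat.prime_five (m := 1) one_ne_zero (by norm_num))

/-- In `ℚ(ζ₅)`: `η' = -η³ - 3η` satisfies `η'² + η² + 5 = 0` (`η'² = -(5-√5)/2`, the conjugate of `η² = -(5+√5)/2`).
[folklore] -/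
theorem zeta5_twist_sq [Fact (Irreducible (cmPolyQ R))] :
    (-cmRoot R ^ 3 - 3 * cmRoot R) ^ 2 + cmRoot R ^ 2 + ((5 : ℤ) : cmField R) = 0 := by
  have ht := cmRoot_quartic R hR
  push_cast at ht ⊢
  linear_combination (cmRoot R ^ 2 + 1) * ht

/-- **`ℚ(ζ₅)/ℚ` is Galois.** [folklore] -/
theorem zeta5_isGalois [Fact (Irreducible (cmPolyQ R))] : IsGalois ℚ (cmField R) :=
  isGalois_of_sq_add R hR _ (zeta5_twist_sq hR)

/-- **`Gal(ℚ(ζ₅)/ℚ)` is cyclic** (`σ : η ↦ -η³ - 3η` has `σ²(η) = -η`). [folklore] -/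
theorem zeta5_isCyclic [Fact (Irreducible (cmPolyQ R))] : IsCyclic (cmField R ≃ₐ[ℚ] cmField R) := by
  have ht := cmRoot_quartic R hR
  push_cast at ht
  refine isCyclic_of_sq_add R hR _ (zeta5_twist_sq hR) (-X ^ 3 - 3 * X) ?_ ?_
  · simp only [map_sub, map_neg, map_mul, map_pow, aeval_X, map_ofNat]
  · simp only [map_sub, map_neg, map_mul, map_pow, aeval_X, map_ofNat]
    linear_combination (cmRoot R ^ 5 + 4 * cmRoot R ^ 3 + 2 * cmRoot R) * ht

/-- **The rows `W8.ℚ(ζ₅).δ`: on EVERY row a CM eightfold with HC in the kernel.** For every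
`δ ∈ cmNormResidueGroup (S² + 5S + 5)` (the index type of `zeta5_table`, `zeta5_rowMap`, parts I/K): `A ≅ B⁴`, `B` a
simple CM abelian surface (CM by `ℚ(ζ₅)`), Weil type `(2,2;2,2)` relative to `ℚ(ζ₅)`, a Rosati-compatible
polarization class of discriminant `δ`, `HodgeConjectureFor A.dim A.X`, `W_E(A) ⊗ ℂ` algebraic.
[cite: Pohlmann1968, Thm. 1] [cite: Deligne1982HodgeCycles, §5 (c) pp. 38–39] -/
theorem zeta5_carrier_rows_hodgeConjectureFor [Fact (Irreducible (realPolyQ R))] (δ : cmNormResidueGroup R) :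
    ∃ (A : AbelianVariety ℂ) (η : A ⟶ A) (h : complexBetti A.X 2) (B : AbelianVariety ℂ),
      Nonempty (A ≅ ⨁ fun _ : Fin 4 => B) ∧ B.IsSimple ∧ B.dim = 2 ∧ IsOfCMType B ∧ A.dim = 8 ∧ IsOfCMType A ∧
      IsWeilTypeCM A η R 2 2 ∧ IsPolarizationClass A.dim A.X h ∧ RosatiCompatible A η h ∧
      HasWeilDiscriminantCM A η R 2 2 h δ ∧ HodgeConjectureFor A.dim A.X ∧
      weilClassesField A η (R.comp (X ^ 2)) (2 * 2) ≤ algebraicClasses A.X 2 := by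
  haveI := zeta5_fact_cmPolyQ hR
  have hroots := roots_real_neg_of_quadratic hR (by norm_num) (by norm_num) (by norm_num)
  haveI : IsCMField (cmField R) := isCMField_cmField hroots
  haveI := zeta5_isGalois hR
  obtain ⟨hRm, hRdeg⟩ := monic_and_natDegree_of_quadratic R hR
  exact carrier_exists_cmEightfold_hodgeConjectureFor_of_isCyclic R hRm hRdeg hroots (zeta5_isCyclic hR) δ

/-- **All ranks over `ℚ(ζ₅)`: rows `W_{4p}.ℚ(ζ₅).δ`, every `p ≥ 1` (`g = 4, 8, 12, …`), every `δ`:** the power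
`B^{2p}` of a SIMPLE CM abelian surface with Weil type of `E`-rank `2p`, a Rosati-compatible polarization class of
discriminant `δ`, HC for `B^{2p}` in the kernel, `W_E ⊗ ℂ` algebraic. [cite: Pohlmann1968, Thm. 1]
[cite: Deligne1982HodgeCycles, §5 (c) pp. 38–39] -/
theorem zeta5_carrier_allRanks_hodgeConjectureFor [Fact (Irreducible (realPolyQ R))] {p : ℕ} (hp : 0 < p)
    (δ : cmNormResidueGroup R) :
    ∃ (B : AbelianVariety ℂ) (η : (⨁ fun _ : Fin (2 * p) => B) ⟶ ⨁ fun _ : Fin (2 * p) => B)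
      (h : complexBetti (⨁ fun _ : Fin (2 * p) => B).X 2),
      B.IsSimple ∧ B.dim = 2 ∧ IsOfCMType B ∧
      IsOfCMType (⨁ fun _ : Fin (2 * p) => B) ∧ IsWeilTypeCM (⨁ fun _ : Fin (2 * p) => B) η R 2 p ∧
      IsPolarizationClass (⨁ fun _ : Fin (2 * p) => B).dim (⨁ fun _ : Fin (2 * p) => B).X h ∧
      RosatiCompatible (⨁ fun _ : Fin (2 * p) => B) η h ∧
      HasWeilDiscriminantCM (⨁ fun _ : Fin (2 * p) => B) η R 2 p h δ ∧
      HodgeConjectureFor (⨁ fun _ : Fin (2 * p) => B).dim (⨁ fun _ : Fin (2 * p) => B).X ∧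
      weilClassesField (⨁ fun _ : Fin (2 * p) => B) η (R.comp (X ^ 2)) (2 * p) ≤
        algebraicClasses (⨁ fun _ : Fin (2 * p) => B).X p := by
  haveI := zeta5_fact_cmPolyQ hR
  have hroots := roots_real_neg_of_quadratic hR (by norm_num) (by norm_num) (by norm_num)
  haveI : IsCMField (cmField R) := isCMField_cmField hroots
  haveI := zeta5_isGalois hR
  obtain ⟨hRm, hRdeg⟩ := monic_and_natDegree_of_quadratic R hR
  exact carrier_exists_simplePower_hodgeConjectureFor_of_isCyclic R hRm hRdeg le_rfl hroots (zeta5_isCyclic hR) hp δ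

end Zeta5

/-! ## §3 `ℚ(√-(2+√2)) ⊂ ℚ(ζ₁₆)`: `R = S² + 4S + 2`, cyclic -/

section SqrtNegTwoPlusSqrtTwo

variable {R : Polynomial ℤ} (hR : R = X ^ 2 + C 4 * X + C 2)
include hR

/-- The `Fact` for `E = ℚ(√-(2+√2)) = ℚ[T]/(T⁴ + 4T² + 2)` (discriminant `8 = 2·2²`). [folklore] -/
theorem sqrtNegTwoPlusSqrtTwo_fact_cmPolyQ : Fact (Irreducible (cmPolyQ R)) :=
  fact_irreducible_cmPolyQ_of_pos hR (by norm_num) (by norm_num)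
    (not_sq_of_eq_prime_mul_sq (ℓ := 2) Nat.prime_two (m := 2) two_ne_zero (by norm_num))

/-- In `ℚ(√-(2+√2))`: `η' = -η³ - 3η` satisfies `η'² + η² + 4 = 0` (`η'² = -(2-√2)`). [folklore] -/
theorem sqrtNegTwoPlusSqrtTwo_twist_sq [Fact (Irreducible (cmPolyQ R))] :
    (-cmRoot R ^ 3 - 3 * cmRoot R) ^ 2 + cmRoot R ^ 2 + ((4 : ℤ) : cmField R) = 0 := by
  have ht := cmRoot_quartic R hR
  push_cast at ht ⊢
  linear_combination (cmRoot R ^ 2 + 2) * ht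

/-- **`ℚ(√-(2+√2))/ℚ` is Galois.** [folklore] -/
theorem sqrtNegTwoPlusSqrtTwo_isGalois [Fact (Irreducible (cmPolyQ R))] : IsGalois ℚ (cmField R) :=
  isGalois_of_sq_add R hR _ (sqrtNegTwoPlusSqrtTwo_twist_sq hR)

/-- **`Gal(ℚ(√-(2+√2))/ℚ)` is cyclic** (`σ : η ↦ -η³ - 3η`, `σ²(η) = -η`). [folklore] -/
theorem sqrtNegTwoPlusSqrtTwo_isCyclic [Fact (Irreducible (cmPolyQ R))] :
    IsCyclic (cmField R ≃ₐ[ℚ] cmField R) := by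
  have ht := cmRoot_quartic R hR
  push_cast at ht
  refine isCyclic_of_sq_add R hR _ (sqrtNegTwoPlusSqrtTwo_twist_sq hR) (-X ^ 3 - 3 * X) ?_ ?_
  · simp only [map_sub, map_neg, map_mul, map_pow, aeval_X, map_ofNat]
  · simp only [map_sub, map_neg, map_mul, map_pow, aeval_X, map_ofNat]
    linear_combination (cmRoot R ^ 5 + 5 * cmRoot R ^ 3 + 5 * cmRoot R) * ht

/-- **The rows `W8.ℚ(√-(2+√2)).δ`: on EVERY row a CM eightfold with HC in the kernel** (`A ≅ B⁴`, `B` a simple CM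
surface; index type of `sqrtNegTwoPlusSqrtTwo_table` / parts K–N). [cite: Pohlmann1968, Thm. 1]
[cite: Deligne1982HodgeCycles, §5 (c) pp. 38–39] -/
theorem sqrtNegTwoPlusSqrtTwo_carrier_rows_hodgeConjectureFor [Fact (Irreducible (realPolyQ R))]
    (δ : cmNormResidueGroup R) :
    ∃ (A : AbelianVariety ℂ) (η : A ⟶ A) (h : complexBetti A.X 2) (B : AbelianVariety ℂ),
      Nonempty (A ≅ ⨁ fun _ : Fin 4 => B) ∧ B.IsSimple ∧ B.dim = 2 ∧ IsOfCMType B ∧ A.dim = 8 ∧ IsOfCMType A ∧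
      IsWeilTypeCM A η R 2 2 ∧ IsPolarizationClass A.dim A.X h ∧ RosatiCompatible A η h ∧
      HasWeilDiscriminantCM A η R 2 2 h δ ∧ HodgeConjectureFor A.dim A.X ∧
      weilClassesField A η (R.comp (X ^ 2)) (2 * 2) ≤ algebraicClasses A.X 2 := by
  haveI := sqrtNegTwoPlusSqrtTwo_fact_cmPolyQ hR
  have hroots := roots_real_neg_of_quadratic hR (by norm_num) (by norm_num) (by norm_num)
  haveI : IsCMField (cmField R) := isCMField_cmField hroots
  haveI := sqrtNegTwoPlusSqrtTwo_isGalois hR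
  obtain ⟨hRm, hRdeg⟩ := monic_and_natDegree_of_quadratic R hR
  exact carrier_exists_cmEightfold_hodgeConjectureFor_of_isCyclic R hRm hRdeg hroots
    (sqrtNegTwoPlusSqrtTwo_isCyclic hR) δ

/-- **All ranks over `ℚ(√-(2+√2))`: rows `W_{4p}.E.δ`, every `p ≥ 1`, every `δ`:** `B^{2p}`, `B` a SIMPLE CM surface,
Weil type of `E`-rank `2p`, polarization class of discriminant `δ`, HC in the kernel, `W_E ⊗ ℂ` algebraic.
[cite: Pohlmann1968, Thm. 1] [cite: Deligne1982HodgeCycles, §5 (c) pp. 38–39] -/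
theorem sqrtNegTwoPlusSqrtTwo_carrier_allRanks_hodgeConjectureFor [Fact (Irreducible (realPolyQ R))] {p : ℕ}
    (hp : 0 < p) (δ : cmNormResidueGroup R) :
    ∃ (B : AbelianVariety ℂ) (η : (⨁ fun _ : Fin (2 * p) => B) ⟶ ⨁ fun _ : Fin (2 * p) => B)
      (h : complexBetti (⨁ fun _ : Fin (2 * p) => B).X 2),
      B.IsSimple ∧ B.dim = 2 ∧ IsOfCMType B ∧
      IsOfCMType (⨁ fun _ : Fin (2 * p) => B) ∧ IsWeilTypeCM (⨁ fun _ : Fin (2 * p) => B) η R 2 p ∧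
      IsPolarizationClass (⨁ fun _ : Fin (2 * p) => B).dim (⨁ fun _ : Fin (2 * p) => B).X h ∧
      RosatiCompatible (⨁ fun _ : Fin (2 * p) => B) η h ∧
      HasWeilDiscriminantCM (⨁ fun _ : Fin (2 * p) => B) η R 2 p h δ ∧
      HodgeConjectureFor (⨁ fun _ : Fin (2 * p) => B).dim (⨁ fun _ : Fin (2 * p) => B).X ∧
      weilClassesField (⨁ fun _ : Fin (2 * p) => B) η (R.comp (X ^ 2)) (2 * p) ≤
        algebraicClasses (⨁ fun _ : Fin (2 * p) => B).X p := by
  haveI := sqrtNegTwoPlusSqrtTwo_fact_cmPolyQ hR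
  have hroots := roots_real_neg_of_quadratic hR (by norm_num) (by norm_num) (by norm_num)
  haveI : IsCMField (cmField R) := isCMField_cmField hroots
  haveI := sqrtNegTwoPlusSqrtTwo_isGalois hR
  obtain ⟨hRm, hRdeg⟩ := monic_and_natDegree_of_quadratic R hR
  exact carrier_exists_simplePower_hodgeConjectureFor_of_isCyclic R hRm hRdeg le_rfl hroots
    (sqrtNegTwoPlusSqrtTwo_isCyclic hR) hp δ

end SqrtNegTwoPlusSqrtTwo





/-! ## §4 `ℚ(√-(3+√2))`: `R = S² + 6S + 7`, NOT Galois (`D₄`), `h(E) = 2` -/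

section SqrtNegThreePlusSqrtTwo

variable {R : Polynomial ℤ} (hR : R = X ^ 2 + C 6 * X + C 7)
include hR

/-- The `Fact` for `E = ℚ(√-(3+√2)) = ℚ[T]/(T⁴ + 6T² + 7)` (discriminant `8 = 2·2²`). [folklore] -/
theorem sqrtNegThreePlusSqrtTwo_fact_cmPolyQ : Fact (Irreducible (cmPolyQ R)) :=
  fact_irreducible_cmPolyQ_of_pos hR (by norm_num) (by norm_num)
    (not_sq_of_eq_prime_mul_sq (ℓ := 2) Nat.prime_two (m := 2) two_ne_zero (by norm_num))

/-- **The rows `W8.ℚ(√-(3+√2)).δ` (the non-Galois census field): on EVERY row a CM eightfold with HC in the kernel**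
(`B⁴`, `B` a SIMPLE CM surface of primitive type — Schappacher —, nondegenerate — Yanai; index type of
`sqrtNegThreePlusSqrtTwo_table` / parts O–W). [cite: Schmidt1984CMArithmetik, Kap. II Satz 1.6]
[cite: Pohlmann1968, Thm. 1] [cite: Deligne1982HodgeCycles, §5 (c) pp. 38–39] -/
theorem sqrtNegThreePlusSqrtTwo_carrier_rows_hodgeConjectureFor [Fact (Irreducible (realPolyQ R))]
    (δ : cmNormResidueGroup R) :
    ∃ (A : AbelianVariety ℂ) (η : A ⟶ A) (h : complexBetti A.X 2),
      A.dim = 8 ∧ IsOfCMType A ∧ IsWeilTypeCM A η R 2 2 ∧ IsPolarizationClass A.dim A.X h ∧ RosatiCompatible A η h ∧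
      HasWeilDiscriminantCM A η R 2 2 h δ ∧ HodgeConjectureFor A.dim A.X ∧
      weilClassesField A η (R.comp (X ^ 2)) (2 * 2) ≤ algebraicClasses A.X 2 := by
  haveI := sqrtNegThreePlusSqrtTwo_fact_cmPolyQ hR
  have hroots := roots_real_neg_of_quadratic hR (by norm_num) (by norm_num) (by norm_num)
  haveI : IsCMField (cmField R) := isCMField_cmField hroots
  obtain ⟨hRm, hRdeg⟩ := monic_and_natDegree_of_quadratic R hR
  exact carrier_exists_cmEightfold_hodgeConjectureFor_of_not_isGalois R hRm hRdeg hroots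
    (sqrtNegThreePlusSqrtTwo_not_isGalois hR) δ

/-- **All ranks over `ℚ(√-(3+√2))`: rows `W_{4p}.E.δ`, every `p ≥ 1`, every `δ`:** a CM member (`B^{2p}`, `B` of
primitive nondegenerate type) with Weil type of `E`-rank `2p`, polarization class of discriminant `δ`, HC in the kernel,
`W_E ⊗ ℂ` algebraic. [cite: Schmidt1984CMArithmetik, Kap. II Satz 1.6] [cite: Pohlmann1968, Thm. 1] -/
theorem sqrtNegThreePlusSqrtTwo_carrier_allRanks_hodgeConjectureFor [Fact (Irreducible (realPolyQ R))] {p : ℕ}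
    (hp : 0 < p) (δ : cmNormResidueGroup R) :
    ∃ (A : AbelianVariety ℂ) (η : A ⟶ A) (h : complexBetti A.X 2),
      IsOfCMType A ∧ IsWeilTypeCM A η R 2 p ∧ IsPolarizationClass A.dim A.X h ∧ RosatiCompatible A η h ∧
      HasWeilDiscriminantCM A η R 2 p h δ ∧ HodgeConjectureFor A.dim A.X ∧
      weilClassesField A η (R.comp (X ^ 2)) (2 * p) ≤ algebraicClasses A.X p := by
  haveI := sqrtNegThreePlusSqrtTwo_fact_cmPolyQ hR
  have hroots := roots_real_neg_of_quadratic hR (by norm_num) (by norm_num) (by norm_num)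
  haveI : IsCMField (cmField R) := isCMField_cmField hroots
  obtain ⟨hRm, hRdeg⟩ := monic_and_natDegree_of_quadratic R hR
  exact carrier_exists_cmMember_hodgeConjectureFor_of_not_isGalois R hRm hRdeg hroots
    (sqrtNegThreePlusSqrtTwo_not_isGalois hR) hp δ

end SqrtNegThreePlusSqrtTwo

end Summit.HodgeConjecture.HodgeConjecture.Ring2.WeilCoverageCM

end
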